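import Mathlib
import Summits.NavierStokesRegularity.NavierStokesRegularity.Theses.PerpetualPump

/-!
# Sketch (ideator 2, generation 2; crux-ideate round 1) — crux `PerpetualPump.CircuitTrace`
(stmt-NavierStokesRegularity-1836)

First-lemma signatures for two idea cards:

* `efficiency-shadow` — `EfficiencyShadow` (exact per-scale energy identity), `TriadFluxBound`,
  the transferred statement `AdversarialDyadicTrace` (C⁺: the trace theorem for the scalar
  Katz–Pavlović cascade run at an ADVERSARIAL efficiency), `ShadowReduction`, and the by-product
  `SubThresholdTypeI` (ε₀-defect critical energy ⇒ no Type-I blow-up below amplitude 1/(2Kε₀)).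
* `terminal-scar` — `TerminalLimit` (modes extend to `t = T`), `TerminalScar` (C⁺: every
  critically bounded blow-up scars its terminal state), `ScarCloses`.

Mathlib-only; the circuit right-hand side is copied verbatim from the crux (`let F := …`).
Notation in docstrings: `e_n(t) := Σ_i X_{i,n}(t)²` (scale energy), `a_n := lam^{n/5} √e_n`
(critical amplitude), `π_n` (triad flux through the cut `n | n+1`), clock of scale `n` = `lam^{4n/5}`.
-/

noncomputable section

set_option linter.dupNamespace false

namespace Summit.NavierStokesRegularity.NavierStokesRegularity.Cruxes.CircuitTrace.Ideator2G2

open Finset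
open Summit.NavierStokesRegularity.NavierStokesRegularity.Theses.PerpetualPump (CircuitTrace)

/-! ## The circuit class (verbatim from the crux) -/

/-- Tao circuit right-hand side ((4.3) at α = 2/5, offsets `S = {0,e₁,e₂,e₃}` labelled
`none, some 0, some 1, some 2`), verbatim the `let F` of `PerpetualPump.CircuitTrace`. -/
def circuitRHS (lam : ℝ) {m : ℕ} (coeff : Fin m → Fin m → Fin m → Option (Fin 3) → ℝ)
    (X : Fin m → ℤ → ℝ → ℝ) (i : Fin m) (n : ℤ) (t : ℝ) : ℝ :=
  -(lam ^ ((4 / 5 : ℝ) * n)) * X i n t +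
    ∑ i₁ : Fin m, ∑ i₂ : Fin m, ∑ μ : Option (Fin 3),
      coeff i₁ i₂ i μ * lam ^ ((n : ℝ) - (if μ = some 2 then 1 else 0)) *
        X i₁ (n + ((if μ = some 0 then 1 else 0) - (if μ = some 2 then 1 else 0))) t *
        X i₂ (n + ((if μ = some 1 then 1 else 0) - (if μ = some 2 then 1 else 0))) t

/-- Tao's symmetry (4.2). (Never used by the shadow — recorded to match the crux.) -/
def IsSymm {m : ℕ} (coeff : Fin m → Fin m → Fin m → Option (Fin 3) → ℝ) : Prop :=
  ∀ (i₁ i₂ i₃ : Fin m) (μ : Option (Fin 3)),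
    coeff i₁ i₂ i₃ μ = coeff i₂ i₁ i₃ (Option.map (Equiv.swap (0 : Fin 3) 1) μ)

/-- Cyclic cancellation (4.3): the only structure the shadow consumes. -/
def IsCyclic {m : ℕ} (coeff : Fin m → Fin m → Fin m → Option (Fin 3) → ℝ) : Prop :=
  ∀ (v : Fin 3 → Fin m) (μ : Option (Fin 3)),
    ∑ σ : Equiv.Perm (Fin 3), coeff (v (σ 0)) (v (σ 1)) (v (σ 2)) (Option.map σ.symm μ) = 0

/-! ## Card `efficiency-shadow` -/

/-- Scale energy `e_n(t) = Σ_i X_{i,n}(t)²` — the only function of the solution that the crux's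
`ℓ³` hypothesis, its `H¹⁰` a-priori bound and its conclusion depend on (up to factors of `m`). -/
def scaleEnergy {m : ℕ} (X : Fin m → ℤ → ℝ → ℝ) (n : ℤ) (t : ℝ) : ℝ :=
  ∑ i : Fin m, (X i n t) ^ 2

/-- Triad flux `π_n(t) = 2 lam^n Σ coeff(i₁,i₂,i₃,(0,0,1)) X_{i₁,n} X_{i₂,n} X_{i₃,n+1}`: the rate at
which the single triad family `{n,n,n+1}` (offset `some 2` = Tao's pump) moves energy from scale `n`
to scale `n+1`.  Every other gate of the circuit (amplifiers, rotors: offset `none`; the pump's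
back-reaction: offsets `some 0, some 1`) is INSIDE `e_n` or is the other end of the same triad. -/
def triadFlux (lam : ℝ) {m : ℕ} (coeff : Fin m → Fin m → Fin m → Option (Fin 3) → ℝ)
    (X : Fin m → ℤ → ℝ → ℝ) (n : ℤ) (t : ℝ) : ℝ :=
  2 * lam ^ (n : ℝ) * ∑ i₁ : Fin m, ∑ i₂ : Fin m, ∑ i₃ : Fin m,
    coeff i₁ i₂ i₃ (some 2) * X i₁ n t * X i₂ n t * X i₃ (n + 1) t

/-- FIRST LEMMA (card `efficiency-shadow`): THE EXACT SCALAR SHADOW.  For every cyclic Tao circuit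
and every scale `n`, pointwise in time and with NO summability / a-priori hypothesis (finite sums
over `Fin m` only):  `ė_n = -2 lam^{4n/5} e_n + π_{n-1} - π_n`.
Proof route: `ė_n = 2 Σ_i X_{i,n} F_{i,n}`; the `none` monomials and the `some 0 / some 1`
monomials are the degree-0 and degree-1 parts (in the scale-`n+1` variable) of the Disproof's
`trilinear_cancel` at base `n`, giving `0` and `-π_n`; the `some 2` monomials at output `n` are
`+π_{n-1}` by definition.  Symmetry (4.2) is not needed. -/
def EfficiencyShadow : Prop :=
  ∀ lam : ℝ, 0 < lam → ∀ (m : ℕ) (coeff : Fin m → Fin m → Fin m → Option (Fin 3) → ℝ),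
    IsCyclic coeff → ∀ (X : Fin m → ℤ → ℝ → ℝ) (n : ℤ) (t : ℝ),
      (∀ (i : Fin m) (n' : ℤ), HasDerivAt (X i n') (circuitRHS lam coeff X i n' t) t) →
      HasDerivAt (scaleEnergy X n)
        (-2 * lam ^ ((4 / 5 : ℝ) * n) * scaleEnergy X n t
          + triadFlux lam coeff X (n - 1) t - triadFlux lam coeff X n t) t

/-- The efficiency is bounded: `|π_n| ≤ 2 K m^{3/2} lam^n e_n √e_{n+1}` (Cauchy–Schwarz over the
modes; `K = max |coeff|`).  In critical units `|π_n| ≤ 2 K m^{3/2} lam^{-1/5} · lam^{2n/5} a_n² a_{n+1}`.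
So `θ_n(t) := π_n / (2 K m^{3/2} lam^n e_n √e_{n+1}) ∈ [-1,1]` — every Tao circuit is the positive
Katz–Pavlović cascade run at a time-dependent EFFICIENCY `θ`; Tao's Thm 4.2 circuit is a design that
makes `θ` switch like a clock autonomously. -/
def TriadFluxBound : Prop :=
  ∀ lam : ℝ, 0 < lam → ∀ (m : ℕ) (coeff : Fin m → Fin m → Fin m → Option (Fin 3) → ℝ) (K : ℝ),
    (∀ i₁ i₂ i₃ μ, |coeff i₁ i₂ i₃ μ| ≤ K) →
      ∀ (X : Fin m → ℤ → ℝ → ℝ) (n : ℤ) (t : ℝ),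
        |triadFlux lam coeff X n t|
          ≤ 2 * K * (m : ℝ) ^ ((3 : ℝ) / 2) * lam ^ (n : ℝ) * scaleEnergy X n t
              * Real.sqrt (scaleEnergy X (n + 1) t)

/-- C⁺ (TRANSFER of card `efficiency-shadow`): THE ADVERSARIAL SCALAR DYADIC TRACE THEOREM.
Quantifies over ALL nonnegative scale-energy fields `e` and ALL flux fields `π` obeying only the
conservative balance `ė_n = -2 lam^{4n/5} e_n + π_{n-1} - π_n` and the efficiency bound
`|π_n| ≤ K lam^n e_n √e_{n+1}` — `m`, `coeff`, (4.2), (4.3) and the vector structure are gone.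
The crux's hypotheses/conclusion read, in these variables: cutoff `e_{n<0} = 0`; a-priori
`sup lam^{8n} e_n < ∞` on compacts (`= (lam^{4n}|X|)²` summed over modes); `ℓ³`:
`Σ_n (lam^{2n/5} e_n)^{3/2} ≤ M`; conclusion `sup lam^{8n} e_n < ∞` on `[0,T)`.
Contains: every `m`-mode signed Tao circuit (via `EfficiencyShadow`+`TriadFluxBound`), the signed
scalar KP model (`θ_n = sgn x_{n+1}`), and Tao's EXOGENOUS (time-dependent coefficient) circuits. -/
def AdversarialDyadicTrace : Prop :=
  ∀ lam : ℝ, 1 < lam → ∀ K : ℝ, 0 ≤ K → ∀ T : ℝ, 0 < T → ∀ e π : ℤ → ℝ → ℝ,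
    (∀ (n : ℤ), ∀ t ∈ Set.Ico 0 T, 0 ≤ e n t) →
    (∀ (n : ℤ), ContinuousOn (e n) (Set.Ico 0 T)) →
    (∀ (n : ℤ), ∀ t ∈ Set.Ioo 0 T,
      HasDerivAt (e n) (-2 * lam ^ ((4 / 5 : ℝ) * n) * e n t + π (n - 1) t - π n t) t) →
    (∀ (n : ℤ), ∀ t ∈ Set.Ioo 0 T, |π n t| ≤ K * lam ^ (n : ℝ) * e n t * Real.sqrt (e (n + 1) t)) →
    (∀ (n : ℤ) (t : ℝ), n < 0 → e n t = 0) →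
    (∀ T' ∈ Set.Ioo 0 T, ∃ C : ℝ, ∀ (n : ℤ), ∀ t ∈ Set.Icc 0 T', lam ^ ((8 : ℝ) * n) * e n t ≤ C) →
    (∃ M : ℝ, ∀ t ∈ Set.Ico 0 T, ∀ s : Finset ℤ,
      ∑ n ∈ s, (lam ^ ((2 / 5 : ℝ) * n) * e n t) ^ ((3 : ℝ) / 2) ≤ M) →
    ∃ C : ℝ, ∀ (n : ℤ), ∀ t ∈ Set.Ico 0 T, lam ^ ((8 : ℝ) * n) * e n t ≤ C

/-- The reduction: `CircuitTrace` is an INSTANCE of `AdversarialDyadicTrace`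
(`e := scaleEnergy X`, `π := triadFlux lam coeff X`, `K := 2 m^{3/2} max|coeff|`, `M ↦ √m·M`;
pure bookkeeping once `EfficiencyShadow` and `TriadFluxBound` are proved:
`(Σ_i |lam^{n/5}X_i|³) ≥ m^{-1/2} (lam^{2n/5} e_n)^{3/2}`, `lam^{8n} e_n ≤ m C²`,
`lam^{4n}|X_{i,n}| ≤ √(lam^{8n} e_n)`). -/
def ShadowReduction : Prop := AdversarialDyadicTrace → CircuitTrace

/-- BY-PRODUCT (ε₀-DEFECT CRITICAL ENERGY; sub-threshold Type-I exclusion).  In the shadow the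
critical (`Ḣ^{1/2}`-type) energy `Σ_n lam^{2n/5} e_n = Σ_n a_n²` obeys
`d/dt Σ lam^{2n/5} e_n = -2 Σ lam^{6n/5} e_n + ε₀ Σ lam^{2n/5} π_n`, `ε₀ := lam^{2/5} - 1`
(= Tao's frequency-localisation parameter exactly when `lam = (1+ε₀)^{5/2}`): moving energy up one
scale GAINS the factor `ε₀` in critical weight.  Under a critical sup bound `a ≤ A` with
`ε₀ K A ≤ lam^{1/5}` the defect is at most half the dissipation, the critical dissipation
`Σ_n ∫ lam^{6n/5} e_n dt` is finite, and infinitely many records are impossible: NO BLOW-UP.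
I.e. the `ℓ^∞` tier (`Disproof.CircuitTraceLinfty`, conjecturally false in general) HOLDS below the
amplitude `lam^{1/5}/(K ε₀)`, and any Type-I pump (crux `CircuitPump`) at scale ratio `(1+ε₀)^{5/2}`
needs `K·A > lam^{1/5}/ε₀ → ∞` as `ε₀ → 0` — the regime `PumpTransfer` requires. -/
def SubThresholdTypeI : Prop :=
  ∀ lam : ℝ, 1 < lam → ∀ K : ℝ, 0 ≤ K → ∀ T : ℝ, 0 < T → ∀ e π : ℤ → ℝ → ℝ,
    (∀ (n : ℤ), ∀ t ∈ Set.Ico 0 T, 0 ≤ e n t) →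
    (∀ (n : ℤ), ContinuousOn (e n) (Set.Ico 0 T)) →
    (∀ (n : ℤ), ∀ t ∈ Set.Ioo 0 T,
      HasDerivAt (e n) (-2 * lam ^ ((4 / 5 : ℝ) * n) * e n t + π (n - 1) t - π n t) t) →
    (∀ (n : ℤ), ∀ t ∈ Set.Ioo 0 T, |π n t| ≤ K * lam ^ (n : ℝ) * e n t * Real.sqrt (e (n + 1) t)) →
    (∀ (n : ℤ) (t : ℝ), n < 0 → e n t = 0) →
    (∀ T' ∈ Set.Ioo 0 T, ∃ C : ℝ, ∀ (n : ℤ), ∀ t ∈ Set.Icc 0 T', lam ^ ((8 : ℝ) * n) * e n t ≤ C) →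
    ∀ A : ℝ, (∀ (n : ℤ), ∀ t ∈ Set.Ico 0 T, lam ^ ((2 / 5 : ℝ) * n) * e n t ≤ A ^ 2) →
      (lam ^ ((2 / 5 : ℝ)) - 1) * K * A ≤ lam ^ ((1 / 5 : ℝ)) →
      ∃ C : ℝ, ∀ (n : ℤ), ∀ t ∈ Set.Ico 0 T, lam ^ ((8 : ℝ) * n) * e n t ≤ C

/-! ## Card `terminal-scar` -/

/-- TERMINAL LIMIT: under a critical sup bound every mode has bounded derivative near `T`
(`|F_{i,n}| ≤ lam^{4n/5}(lam^{-n/5}A + 4 m² K lam^{3n/5-…} A²)`), hence extends continuously to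
`t = T`: the terminal state `X(T)` exists mode-wise, with `a(T) ≤ A`, and — by Fatou — it inherits
every summability the crux assumes for `t < T` (`ℓ³ ≤ M` ⇒ `a(T) ∈ ℓ³ ⊂ c₀`). -/
def TerminalLimit : Prop :=
  ∀ lam : ℝ, 1 < lam → ∀ (m : ℕ) (coeff : Fin m → Fin m → Fin m → Option (Fin 3) → ℝ)
    (T : ℝ) (X : Fin m → ℤ → ℝ → ℝ), 0 < T →
    (∀ (i : Fin m) (n : ℤ), ∀ t ∈ Set.Ioo 0 T, HasDerivAt (X i n) (circuitRHS lam coeff X i n t) t) →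
    (∀ (i : Fin m) (n : ℤ) (t : ℝ), n < 0 → X i n t = 0) →
    (∃ A : ℝ, ∀ (i : Fin m) (n : ℤ), ∀ t ∈ Set.Ico 0 T, lam ^ ((1 / 5 : ℝ) * n) * |X i n t| ≤ A) →
    ∀ (i : Fin m) (n : ℤ), ∃ L : ℝ, Filter.Tendsto (X i n) (nhdsWithin T (Set.Iio T)) (nhds L)

/-- C⁺ (TRANSFER of card `terminal-scar`): THE TERMINAL SCAR THEOREM — the `ℓ^∞`-tier structure
theorem behind every `ℓ^q` (`q < ∞`) criterion.  A solution of the crux's class with bounded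
critical sup-norm `a ≤ A` (no `ℓ³`!) that blows up at `T` keeps, at INFINITELY MANY scales `n`, a
critical amplitude `≥ ρ(lam,m,coeff,A) > 0` on a whole final interval `[t₀(n), T)`: the terminal
critical profile does not tend to zero ("scar"; the lattice `|x|^{-1}` profile of a Type-I
singularity at the final time).  Proof route: synchrony (every large scale `δ`-active within `D`
own-clock units of `T` — cards quiet-valve-budget / ramp-energy-type-one-clock) + ONE weighted
backward Grönwall per scale on `[s_n, T)` (Disproof `block_backward_gronwall`, critical-unit form =
card clock-discounted-trail-mass `TraceInequality`).  No counting, no `ℓ³`. -/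
def TerminalScar : Prop :=
  ∀ lam : ℝ, 1 < lam → ∀ (m : ℕ) (coeff : Fin m → Fin m → Fin m → Option (Fin 3) → ℝ),
    IsSymm coeff → IsCyclic coeff → ∀ T : ℝ, 0 < T → ∀ X : Fin m → ℤ → ℝ → ℝ,
    (∀ (i : Fin m) (n : ℤ), ContinuousOn (X i n) (Set.Ico 0 T)) →
    (∀ (i : Fin m) (n : ℤ), ∀ t ∈ Set.Ioo 0 T, HasDerivAt (X i n) (circuitRHS lam coeff X i n t) t) →
    (∀ (i : Fin m) (n : ℤ) (t : ℝ), n < 0 → X i n t = 0) →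
    (∀ T' ∈ Set.Ioo 0 T, ∃ C : ℝ, ∀ (i : Fin m) (n : ℤ), ∀ t ∈ Set.Icc 0 T',
        lam ^ ((4 : ℝ) * n) * |X i n t| ≤ C) →
    ∀ A : ℝ, (∀ (i : Fin m) (n : ℤ), ∀ t ∈ Set.Ico 0 T, lam ^ ((1 / 5 : ℝ) * n) * |X i n t| ≤ A) →
    (¬ ∃ C : ℝ, ∀ (i : Fin m) (n : ℤ), ∀ t ∈ Set.Ico 0 T, lam ^ ((4 : ℝ) * n) * |X i n t| ≤ C) →
    ∃ ρ : ℝ, 0 < ρ ∧ ∀ N : ℕ, ∃ n : ℤ, (N : ℤ) ≤ n ∧ ∃ t₀ ∈ Set.Ico 0 T, ∀ t ∈ Set.Ico t₀ T,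
      ρ ≤ lam ^ ((1 / 5 : ℝ) * n) * ∑ i : Fin m, |X i n t|

/-- How the scar closes the crux (bookkeeping): `ℓ³ ≤ M` gives the critical sup bound
`A = max M 1`; if the conclusion failed, `TerminalScar` gives `k > m² M / ρ³` scarred scales with
final intervals `[t₀(n_j), T)`; at `t* = max_j t₀(n_j) < T` all `k` are simultaneously `≥ ρ`, and
`Σ_i (lam^{n/5}|X_{i,n}|)³ ≥ m^{-2} (lam^{n/5} Σ_i |X_{i,n}|)³ ≥ ρ³/m²` per scale contradicts the
`ℓ³` bound on the finite set `{n_1,…,n_k}`.  The same two lines close `Disproof.CircuitTraceLq q`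
for every `q < ∞` and the Orlicz-edge version `sup_t Σ_n Φ(a_n(t)) < ∞` for ANY `Φ > 0` on `(0,∞)`. -/
def ScarCloses : Prop := TerminalScar → CircuitTrace

/-! # PROOFS (card `efficiency-shadow`): the exact scalar shadow identity, kernel-checked

Everything below is sorry-free: `trilinear_cancel` (copied from Disproof.lean, cyclic only), its
triple-index degree-0 / degree-1 consequences, the expansion of `circuitRHS`, the key algebraic identity
`shadow_key`, `efficiencyShadow_holds : EfficiencyShadow`, and the Cauchy–Schwarz efficiency bound
`triadFluxBound_holds : TriadFluxBound`, and the full reduction `shadowReduction_holds : ShadowReduction`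
(`AdversarialDyadicTrace → CircuitTrace`: the crux IS an instance of the scalar statement); and, for card
`terminal-scar`, `terminalLimit_holds : TerminalLimit` (modes extend continuously to the blow-up time) and the endgame
`scarCloses_holds : ScarCloses` (`TerminalScar → CircuitTrace`). -/

/-! ## Cyclic cancellation (copied from Disproof.lean `trilinear_cancel`, cyclic only) -/

theorem trilinear_cancel {m : ℕ} {coeff : Fin m → Fin m → Fin m → Option (Fin 3) → ℝ}
    (hcyc : IsCyclic coeff) (Y Z : Fin m → ℝ) :
    ∑ v : Fin 3 → Fin m, ∑ μ : Option (Fin 3),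
      coeff (v 0) (v 1) (v 2) μ * ∏ a : Fin 3, (if μ = some a then Z else Y) (v a) = 0 := by
  set P : (Fin 3 → Fin m) → Option (Fin 3) → ℝ :=
    fun v μ => ∏ a : Fin 3, (if μ = some a then Z else Y) (v a) with hPdef
  have hP : ∀ (σ : Equiv.Perm (Fin 3)) (v : Fin 3 → Fin m) (μ : Option (Fin 3)),
      P (v ∘ σ) (Option.map σ.symm μ) = P v μ := by
    intro σ v μ
    simp only [hPdef, Function.comp_apply]
    rw [← Equiv.prod_comp σ (fun b => (if μ = some b then Z else Y) (v b))]
    refine Finset.prod_congr rfl fun a _ => ?_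
    rcases μ with _ | b
    · simp
    · have : (Option.map (⇑σ.symm) (some b) = some a) = (some b = some (σ a)) := by
        rw [Option.map_some, Option.some.injEq, Option.some.injEq, eq_iff_iff]
        exact Equiv.symm_apply_eq σ
      simp only [this]
  change ∑ v : Fin 3 → Fin m, ∑ μ : Option (Fin 3), coeff (v 0) (v 1) (v 2) μ * P v μ = 0
  set S := ∑ v : Fin 3 → Fin m, ∑ μ : Option (Fin 3), coeff (v 0) (v 1) (v 2) μ * P v μ with hS
  have hSσ : ∀ σ : Equiv.Perm (Fin 3),
      S = ∑ v : Fin 3 → Fin m, ∑ μ : Option (Fin 3),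
        coeff (v (σ 0)) (v (σ 1)) (v (σ 2)) (Option.map σ.symm μ) * P v μ := by
    intro σ
    rw [hS, ← Equiv.sum_comp (σ.symm.arrowCongr (Equiv.refl (Fin m)))]
    refine Finset.sum_congr rfl fun v _ => ?_
    rw [← Equiv.sum_comp (Equiv.optionCongr σ.symm)]
    refine Finset.sum_congr rfl fun μ _ => ?_
    have hv : (σ.symm.arrowCongr (Equiv.refl (Fin m))) v = v ∘ σ := rfl
    rw [hv, Equiv.optionCongr_apply, hP σ v μ]
    rfl
  have h6 : (6 : ℝ) * S = 0 := by
    have : ∑ _σ : Equiv.Perm (Fin 3), S = 6 * S := by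
      rw [Finset.sum_const, Finset.card_univ, Fintype.card_perm, Fintype.card_fin, nsmul_eq_mul]
      norm_num [Nat.factorial]
    rw [← this, Finset.sum_congr rfl fun σ _ => hSσ σ, Finset.sum_comm]
    refine Finset.sum_eq_zero fun v _ => ?_
    rw [Finset.sum_comm]
    refine Finset.sum_eq_zero fun μ _ => ?_
    rw [← Finset.sum_mul, hcyc v μ, zero_mul]
  linarith

/-! ## Triple-index forms of cyclicity -/

/-- `(Fin 3 → Fin m) ≃ Fin m × Fin m × Fin m`. -/
def fin3Equiv (m : ℕ) : (Fin 3 → Fin m) ≃ Fin m × Fin m × Fin m where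
  toFun v := (v 0, v 1, v 2)
  invFun p := ![p.1, p.2.1, p.2.2]
  left_inv v := by
    funext j
    fin_cases j <;> rfl
  right_inv p := by rfl

theorem sum_fin3_fun {m : ℕ} (g : Fin m → Fin m → Fin m → ℝ) :
    ∑ v : Fin 3 → Fin m, g (v 0) (v 1) (v 2) = ∑ i₁ : Fin m, ∑ i₂ : Fin m, ∑ i₃ : Fin m, g i₁ i₂ i₃ := by
  rw [Fintype.sum_equiv (fin3Equiv m) (fun v => g (v 0) (v 1) (v 2))
    (fun p => g p.1 p.2.1 p.2.2) (fun v => rfl)]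
  rw [Fintype.sum_prod_type]
  refine Finset.sum_congr rfl fun i₁ _ => ?_
  rw [Fintype.sum_prod_type]

/-- Expansion of the `μ`-sum in `trilinear_cancel`. -/
theorem cyc_expand {m : ℕ} (coeff : Fin m → Fin m → Fin m → Option (Fin 3) → ℝ)
    (Y Z : Fin m → ℝ) (v : Fin 3 → Fin m) :
    ∑ μ : Option (Fin 3), coeff (v 0) (v 1) (v 2) μ * ∏ a : Fin 3, (if μ = some a then Z else Y) (v a)
      = coeff (v 0) (v 1) (v 2) none * Y (v 0) * Y (v 1) * Y (v 2)
        + (coeff (v 0) (v 1) (v 2) (some 0) * Z (v 0) * Y (v 1) * Y (v 2)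
          + coeff (v 0) (v 1) (v 2) (some 1) * Y (v 0) * Z (v 1) * Y (v 2)
          + coeff (v 0) (v 1) (v 2) (some 2) * Y (v 0) * Y (v 1) * Z (v 2)) := by
  rw [Fintype.sum_option, Fin.sum_univ_three]
  simp only [Fin.prod_univ_three, Fin.isValue, reduceCtorEq, ite_false, Option.some.injEq]
  have h01 : ((0 : Fin 3) = 1) = False := by decide
  have h02 : ((0 : Fin 3) = 2) = False := by decide
  have h10 : ((1 : Fin 3) = 0) = False := by decide
  have h12 : ((1 : Fin 3) = 2) = False := by decide
  have h20 : ((2 : Fin 3) = 0) = False := by decide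
  have h21 : ((2 : Fin 3) = 1) = False := by decide
  simp only [h01, h02, h10, h12, h20, h21, ite_true, ite_false]
  ring

theorem cyc_deg0 {m : ℕ} {coeff : Fin m → Fin m → Fin m → Option (Fin 3) → ℝ}
    (hcyc : IsCyclic coeff) (Y : Fin m → ℝ) :
    ∑ i₁ : Fin m, ∑ i₂ : Fin m, ∑ i₃ : Fin m, coeff i₁ i₂ i₃ none * Y i₁ * Y i₂ * Y i₃ = 0 := by
  have h := trilinear_cancel hcyc Y 0
  rw [Finset.sum_congr rfl (fun v _ => cyc_expand coeff Y 0 v)] at h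
  simp only [Pi.zero_apply, mul_zero, zero_mul, add_zero] at h
  rw [sum_fin3_fun (fun i₁ i₂ i₃ => coeff i₁ i₂ i₃ none * Y i₁ * Y i₂ * Y i₃)] at h
  exact h

theorem cyc_deg1 {m : ℕ} {coeff : Fin m → Fin m → Fin m → Option (Fin 3) → ℝ}
    (hcyc : IsCyclic coeff) (Y Z : Fin m → ℝ) :
    ∑ i₁ : Fin m, ∑ i₂ : Fin m, ∑ i₃ : Fin m,
      (coeff i₁ i₂ i₃ (some 0) * Z i₁ * Y i₂ * Y i₃
        + coeff i₁ i₂ i₃ (some 1) * Y i₁ * Z i₂ * Y i₃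
        + coeff i₁ i₂ i₃ (some 2) * Y i₁ * Y i₂ * Z i₃) = 0 := by
  have h := trilinear_cancel hcyc Y Z
  rw [Finset.sum_congr rfl (fun v _ => cyc_expand coeff Y Z v)] at h
  rw [Finset.sum_add_distrib] at h
  rw [sum_fin3_fun (fun i₁ i₂ i₃ => coeff i₁ i₂ i₃ none * Y i₁ * Y i₂ * Y i₃), cyc_deg0 hcyc Y,
    zero_add] at h
  rw [sum_fin3_fun (fun i₁ i₂ i₃ => coeff i₁ i₂ i₃ (some 0) * Z i₁ * Y i₂ * Y i₃
        + coeff i₁ i₂ i₃ (some 1) * Y i₁ * Z i₂ * Y i₃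
        + coeff i₁ i₂ i₃ (some 2) * Y i₁ * Y i₂ * Z i₃)] at h
  exact h

/-! ## Expansion of the circuit right-hand side -/

theorem sum_rotate {m : ℕ} (f : Fin m → Fin m → Fin m → ℝ) :
    ∑ i : Fin m, ∑ i₁ : Fin m, ∑ i₂ : Fin m, f i i₁ i₂
      = ∑ i₁ : Fin m, ∑ i₂ : Fin m, ∑ i : Fin m, f i i₁ i₂ := by
  rw [Finset.sum_comm]
  exact Finset.sum_congr rfl (fun i₁ _ => Finset.sum_comm)

/-- Pointwise expansion of the `μ`-sum of `circuitRHS`. -/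
theorem circuitRHS_expand (lam : ℝ) {m : ℕ} (coeff : Fin m → Fin m → Fin m → Option (Fin 3) → ℝ)
    (X : Fin m → ℤ → ℝ → ℝ) (i : Fin m) (n : ℤ) (t : ℝ) :
    circuitRHS lam coeff X i n t =
      -(lam ^ ((4 / 5 : ℝ) * n)) * X i n t
      + (lam ^ (n : ℝ) * ∑ i₁ : Fin m, ∑ i₂ : Fin m, coeff i₁ i₂ i none * X i₁ n t * X i₂ n t
      + lam ^ (n : ℝ) * ∑ i₁ : Fin m, ∑ i₂ : Fin m, coeff i₁ i₂ i (some 0) * X i₁ (n + 1) t * X i₂ n t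
      + lam ^ (n : ℝ) * ∑ i₁ : Fin m, ∑ i₂ : Fin m, coeff i₁ i₂ i (some 1) * X i₁ n t * X i₂ (n + 1) t
      + lam ^ ((n : ℝ) - 1) * ∑ i₁ : Fin m, ∑ i₂ : Fin m,
          coeff i₁ i₂ i (some 2) * X i₁ (n - 1) t * X i₂ (n - 1) t) := by
  have h01 : ((0 : Fin 3) = 1) = False := by decide
  have h02 : ((0 : Fin 3) = 2) = False := by decide
  have h10 : ((1 : Fin 3) = 0) = False := by decide
  have h12 : ((1 : Fin 3) = 2) = False := by decide
  have h20 : ((2 : Fin 3) = 0) = False := by decide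
  have h21 : ((2 : Fin 3) = 1) = False := by decide
  have hμ : ∀ i₁ i₂ : Fin m,
      (∑ μ : Option (Fin 3), coeff i₁ i₂ i μ * lam ^ ((n : ℝ) - (if μ = some 2 then 1 else 0)) *
        X i₁ (n + ((if μ = some 0 then 1 else 0) - (if μ = some 2 then 1 else 0))) t *
        X i₂ (n + ((if μ = some 1 then 1 else 0) - (if μ = some 2 then 1 else 0))) t)
      = lam ^ (n : ℝ) * (coeff i₁ i₂ i none * X i₁ n t * X i₂ n t)
        + lam ^ (n : ℝ) * (coeff i₁ i₂ i (some 0) * X i₁ (n + 1) t * X i₂ n t)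
        + lam ^ (n : ℝ) * (coeff i₁ i₂ i (some 1) * X i₁ n t * X i₂ (n + 1) t)
        + lam ^ ((n : ℝ) - 1) * (coeff i₁ i₂ i (some 2) * X i₁ (n - 1) t * X i₂ (n - 1) t) := by
    intro i₁ i₂
    rw [Fintype.sum_option, Fin.sum_univ_three]
    simp only [Fin.isValue, reduceCtorEq, ite_false, ite_true, Option.some.injEq, h01, h02, h10, h12,
      h20, h21, sub_zero, add_zero, zero_sub, sub_self, ← sub_eq_add_neg]
    ring
  unfold circuitRHS
  rw [Finset.sum_congr rfl (fun i₁ _ => Finset.sum_congr rfl (fun i₂ _ => hμ i₁ i₂))]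
  simp only [Finset.sum_add_distrib, Finset.mul_sum]

/-! ## The key algebraic identity and the shadow -/

theorem shadow_key {lam : ℝ} {m : ℕ} {coeff : Fin m → Fin m → Fin m → Option (Fin 3) → ℝ}
    (hcyc : IsCyclic coeff) (X : Fin m → ℤ → ℝ → ℝ) (n : ℤ) (t : ℝ) :
    ∑ i : Fin m, 2 * X i n t * circuitRHS lam coeff X i n t
      = -2 * lam ^ ((4 / 5 : ℝ) * n) * scaleEnergy X n t
        + triadFlux lam coeff X (n - 1) t - triadFlux lam coeff X n t := by
  have h0 := cyc_deg0 hcyc (fun j => X j n t)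
  have h1 := cyc_deg1 hcyc (fun j => X j n t) (fun j => X j (n + 1) t)
  beta_reduce at h0 h1
  have h1' : (∑ i₁ : Fin m, ∑ i₂ : Fin m, ∑ i₃ : Fin m,
        coeff i₁ i₂ i₃ (some 0) * X i₁ (n + 1) t * X i₂ n t * X i₃ n t)
      + (∑ i₁ : Fin m, ∑ i₂ : Fin m, ∑ i₃ : Fin m,
        coeff i₁ i₂ i₃ (some 1) * X i₁ n t * X i₂ (n + 1) t * X i₃ n t)
      + (∑ i₁ : Fin m, ∑ i₂ : Fin m, ∑ i₃ : Fin m,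
        coeff i₁ i₂ i₃ (some 2) * X i₁ n t * X i₂ n t * X i₃ (n + 1) t) = 0 := by
    simpa only [Finset.sum_add_distrib] using h1
  have hU0 : ∑ i : Fin m, X i n t * (∑ i₁ : Fin m, ∑ i₂ : Fin m, coeff i₁ i₂ i none * X i₁ n t * X i₂ n t)
      = ∑ i₁ : Fin m, ∑ i₂ : Fin m, ∑ i₃ : Fin m, coeff i₁ i₂ i₃ none * X i₁ n t * X i₂ n t * X i₃ n t := by
    simp only [Finset.mul_sum]
    rw [sum_rotate]
    refine Finset.sum_congr rfl fun i₁ _ => Finset.sum_congr rfl fun i₂ _ =>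
      Finset.sum_congr rfl fun i₃ _ => ?_
    ring
  have hU1 : ∑ i : Fin m, X i n t *
        (∑ i₁ : Fin m, ∑ i₂ : Fin m, coeff i₁ i₂ i (some 0) * X i₁ (n + 1) t * X i₂ n t)
      = ∑ i₁ : Fin m, ∑ i₂ : Fin m, ∑ i₃ : Fin m,
          coeff i₁ i₂ i₃ (some 0) * X i₁ (n + 1) t * X i₂ n t * X i₃ n t := by
    simp only [Finset.mul_sum]
    rw [sum_rotate]
    refine Finset.sum_congr rfl fun i₁ _ => Finset.sum_congr rfl fun i₂ _ =>
      Finset.sum_congr rfl fun i₃ _ => ?_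
    ring
  have hU2 : ∑ i : Fin m, X i n t *
        (∑ i₁ : Fin m, ∑ i₂ : Fin m, coeff i₁ i₂ i (some 1) * X i₁ n t * X i₂ (n + 1) t)
      = ∑ i₁ : Fin m, ∑ i₂ : Fin m, ∑ i₃ : Fin m,
          coeff i₁ i₂ i₃ (some 1) * X i₁ n t * X i₂ (n + 1) t * X i₃ n t := by
    simp only [Finset.mul_sum]
    rw [sum_rotate]
    refine Finset.sum_congr rfl fun i₁ _ => Finset.sum_congr rfl fun i₂ _ =>
      Finset.sum_congr rfl fun i₃ _ => ?_
    ring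
  have hU3 : ∑ i : Fin m, X i n t *
        (∑ i₁ : Fin m, ∑ i₂ : Fin m, coeff i₁ i₂ i (some 2) * X i₁ (n - 1) t * X i₂ (n - 1) t)
      = ∑ i₁ : Fin m, ∑ i₂ : Fin m, ∑ i₃ : Fin m,
          coeff i₁ i₂ i₃ (some 2) * X i₁ (n - 1) t * X i₂ (n - 1) t * X i₃ n t := by
    simp only [Finset.mul_sum]
    rw [sum_rotate]
    refine Finset.sum_congr rfl fun i₁ _ => Finset.sum_congr rfl fun i₂ _ =>
      Finset.sum_congr rfl fun i₃ _ => ?_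
    ring
  have hL : ∑ i : Fin m, 2 * X i n t * circuitRHS lam coeff X i n t
      = (-2 * lam ^ ((4 / 5 : ℝ) * n)) * (∑ i : Fin m, (X i n t) ^ 2)
        + (2 * lam ^ (n : ℝ)) * (∑ i : Fin m, X i n t *
            (∑ i₁ : Fin m, ∑ i₂ : Fin m, coeff i₁ i₂ i none * X i₁ n t * X i₂ n t))
        + (2 * lam ^ (n : ℝ)) * (∑ i : Fin m, X i n t *
            (∑ i₁ : Fin m, ∑ i₂ : Fin m, coeff i₁ i₂ i (some 0) * X i₁ (n + 1) t * X i₂ n t))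
        + (2 * lam ^ (n : ℝ)) * (∑ i : Fin m, X i n t *
            (∑ i₁ : Fin m, ∑ i₂ : Fin m, coeff i₁ i₂ i (some 1) * X i₁ n t * X i₂ (n + 1) t))
        + (2 * lam ^ ((n : ℝ) - 1)) * (∑ i : Fin m, X i n t *
            (∑ i₁ : Fin m, ∑ i₂ : Fin m, coeff i₁ i₂ i (some 2) * X i₁ (n - 1) t * X i₂ (n - 1) t)) := by
    rw [Finset.mul_sum, Finset.mul_sum, Finset.mul_sum, Finset.mul_sum, Finset.mul_sum,
      ← Finset.sum_add_distrib, ← Finset.sum_add_distrib, ← Finset.sum_add_distrib,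
      ← Finset.sum_add_distrib]
    refine Finset.sum_congr rfl fun i _ => ?_
    rw [circuitRHS_expand]
    ring
  rw [hL, hU0, hU1, hU2, hU3, h0]
  unfold scaleEnergy triadFlux
  push_cast
  simp only [sub_add_cancel]
  linear_combination (2 * lam ^ (n : ℝ)) * h1'

theorem hasDerivAt_scaleEnergy {lam : ℝ} {m : ℕ}
    (coeff : Fin m → Fin m → Fin m → Option (Fin 3) → ℝ) (X : Fin m → ℤ → ℝ → ℝ) (n : ℤ) (t : ℝ)
    (hX : ∀ (i : Fin m) (n' : ℤ), HasDerivAt (X i n') (circuitRHS lam coeff X i n' t) t) :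
    HasDerivAt (scaleEnergy X n) (∑ i : Fin m, 2 * X i n t * circuitRHS lam coeff X i n t) t := by
  have h2 : ∀ i ∈ (Finset.univ : Finset (Fin m)),
      HasDerivAt (fun s => (X i n s) ^ 2) (2 * X i n t * circuitRHS lam coeff X i n t) t := by
    intro i _
    have := (hX i n).pow 2
    refine this.congr_deriv ?_
    norm_num
  have hs := HasDerivAt.sum h2
  have key : scaleEnergy X n = ∑ i : Fin m, fun s => (X i n s) ^ 2 := by
    funext s
    simp [scaleEnergy, Finset.sum_apply]
  rw [key]
  exact hs

/-- THE EXACT SCALAR SHADOW (First lemma of card `efficiency-shadow`), proved. -/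
theorem efficiencyShadow {lam : ℝ} (_hlam : 0 < lam) {m : ℕ}
    {coeff : Fin m → Fin m → Fin m → Option (Fin 3) → ℝ} (hcyc : IsCyclic coeff)
    (X : Fin m → ℤ → ℝ → ℝ) (n : ℤ) (t : ℝ)
    (hX : ∀ (i : Fin m) (n' : ℤ), HasDerivAt (X i n') (circuitRHS lam coeff X i n' t) t) :
    HasDerivAt (scaleEnergy X n)
      (-2 * lam ^ ((4 / 5 : ℝ) * n) * scaleEnergy X n t
        + triadFlux lam coeff X (n - 1) t - triadFlux lam coeff X n t) t :=
  (hasDerivAt_scaleEnergy coeff X n t hX).congr_deriv (shadow_key hcyc X n t)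

/-! ## The efficiency bound (Cauchy–Schwarz over the modes) -/

theorem three_halves_eq (x : ℝ) (hx : 0 ≤ x) : x ^ ((3 : ℝ) / 2) = x * Real.sqrt x := by
  have h : (3 : ℝ) / 2 = 1 + 1 / 2 := by norm_num
  rw [h, Real.rpow_add' hx (by norm_num), Real.rpow_one, Real.sqrt_eq_rpow]

theorem triadFluxBound {lam : ℝ} (hlam : 0 < lam) {m : ℕ}
    (coeff : Fin m → Fin m → Fin m → Option (Fin 3) → ℝ) (K : ℝ)
    (hK : ∀ i₁ i₂ i₃ μ, |coeff i₁ i₂ i₃ μ| ≤ K) (X : Fin m → ℤ → ℝ → ℝ) (n : ℤ) (t : ℝ) :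
    |triadFlux lam coeff X n t|
      ≤ 2 * K * (m : ℝ) ^ ((3 : ℝ) / 2) * lam ^ (n : ℝ) * scaleEnergy X n t
          * Real.sqrt (scaleEnergy X (n + 1) t) := by
  rcases Nat.eq_zero_or_pos m with rfl | hm
  · simp [triadFlux, scaleEnergy]
  -- abbreviations
  set A : ℝ := ∑ i : Fin m, |X i n t| with hA
  set B : ℝ := ∑ i : Fin m, |X i (n + 1) t| with hB
  set e : ℝ := scaleEnergy X n t with he
  set f : ℝ := scaleEnergy X (n + 1) t with hf
  have hK0 : 0 ≤ K := le_trans (abs_nonneg _) (hK ⟨0, hm⟩ ⟨0, hm⟩ ⟨0, hm⟩ none)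
  have hA0 : 0 ≤ A := Finset.sum_nonneg fun i _ => abs_nonneg _
  have hB0 : 0 ≤ B := Finset.sum_nonneg fun i _ => abs_nonneg _
  have he0 : 0 ≤ e := Finset.sum_nonneg fun i _ => sq_nonneg _
  have hf0 : 0 ≤ f := Finset.sum_nonneg fun i _ => sq_nonneg _
  have hlamn : 0 ≤ lam ^ (n : ℝ) := (Real.rpow_pos_of_pos hlam _).le
  -- Cauchy–Schwarz: A² ≤ m e, B ≤ √m √f
  have hA2 : A ^ 2 ≤ (m : ℝ) * e := by
    have := sq_sum_le_card_mul_sum_sq (s := (Finset.univ : Finset (Fin m))) (f := fun i => |X i n t|)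
    simp only [Finset.card_univ, Fintype.card_fin, sq_abs] at this
    simpa [hA, he, scaleEnergy] using this
  have hB2 : B ^ 2 ≤ (m : ℝ) * f := by
    have := sq_sum_le_card_mul_sum_sq (s := (Finset.univ : Finset (Fin m))) (f := fun i => |X i (n + 1) t|)
    simp only [Finset.card_univ, Fintype.card_fin, sq_abs] at this
    simpa [hB, hf, scaleEnergy] using this
  have hBle : B ≤ Real.sqrt (m : ℝ) * Real.sqrt f := by
    rw [← Real.sqrt_mul (Nat.cast_nonneg m)]
    have := Real.abs_le_sqrt hB2
    rwa [abs_of_nonneg hB0] at this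
  -- the triple sum is bounded by K A² B
  have hS : |∑ i₁ : Fin m, ∑ i₂ : Fin m, ∑ i₃ : Fin m,
      coeff i₁ i₂ i₃ (some 2) * X i₁ n t * X i₂ n t * X i₃ (n + 1) t| ≤ K * A * A * B := by
    calc |∑ i₁ : Fin m, ∑ i₂ : Fin m, ∑ i₃ : Fin m,
          coeff i₁ i₂ i₃ (some 2) * X i₁ n t * X i₂ n t * X i₃ (n + 1) t|
        ≤ ∑ i₁ : Fin m, ∑ i₂ : Fin m, ∑ i₃ : Fin m,
            |coeff i₁ i₂ i₃ (some 2) * X i₁ n t * X i₂ n t * X i₃ (n + 1) t| := by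
          refine (Finset.abs_sum_le_sum_abs _ _).trans (Finset.sum_le_sum fun i₁ _ => ?_)
          refine (Finset.abs_sum_le_sum_abs _ _).trans (Finset.sum_le_sum fun i₂ _ => ?_)
          exact Finset.abs_sum_le_sum_abs _ _
      _ ≤ ∑ i₁ : Fin m, ∑ i₂ : Fin m, ∑ i₃ : Fin m, K * |X i₁ n t| * |X i₂ n t| * |X i₃ (n + 1) t| := by
          refine Finset.sum_le_sum fun i₁ _ => Finset.sum_le_sum fun i₂ _ =>
            Finset.sum_le_sum fun i₃ _ => ?_
          rw [abs_mul, abs_mul, abs_mul]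
          have h1 : 0 ≤ |X i₁ n t| * |X i₂ n t| * |X i₃ (n + 1) t| := by positivity
          calc |coeff i₁ i₂ i₃ (some 2)| * |X i₁ n t| * |X i₂ n t| * |X i₃ (n + 1) t|
              = |coeff i₁ i₂ i₃ (some 2)| * (|X i₁ n t| * |X i₂ n t| * |X i₃ (n + 1) t|) := by ring
            _ ≤ K * (|X i₁ n t| * |X i₂ n t| * |X i₃ (n + 1) t|) :=
                mul_le_mul_of_nonneg_right (hK _ _ _ _) h1
            _ = K * |X i₁ n t| * |X i₂ n t| * |X i₃ (n + 1) t| := by ring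
      _ = K * A * A * B := by
          rw [sum_rotate, sum_rotate, hA, hB]
          simp only [Finset.sum_mul, Finset.mul_sum]
          try (refine Finset.sum_congr rfl fun i₁ _ => Finset.sum_congr rfl fun i₂ _ =>
            Finset.sum_congr rfl fun i₃ _ => ?_; ring)
  -- assemble
  have hAAB : A * A * B ≤ ((m : ℝ) * e) * (Real.sqrt (m : ℝ) * Real.sqrt f) := by
    have hAA : A * A ≤ (m : ℝ) * e := by nlinarith [hA2]
    exact mul_le_mul hAA hBle hB0 (by positivity)
  have hm32 : (m : ℝ) ^ ((3 : ℝ) / 2) = (m : ℝ) * Real.sqrt (m : ℝ) := three_halves_eq _ (Nat.cast_nonneg m)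
  unfold triadFlux
  rw [abs_mul, abs_mul, abs_of_nonneg hlamn, abs_of_pos (by norm_num : (0 : ℝ) < 2)]
  calc 2 * lam ^ (n : ℝ) * |∑ i₁ : Fin m, ∑ i₂ : Fin m, ∑ i₃ : Fin m,
          coeff i₁ i₂ i₃ (some 2) * X i₁ n t * X i₂ n t * X i₃ (n + 1) t|
      ≤ 2 * lam ^ (n : ℝ) * (K * A * A * B) := by
        exact mul_le_mul_of_nonneg_left hS (by positivity)
    _ = 2 * lam ^ (n : ℝ) * K * (A * A * B) := by ring
    _ ≤ 2 * lam ^ (n : ℝ) * K * (((m : ℝ) * e) * (Real.sqrt (m : ℝ) * Real.sqrt f)) := by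
        exact mul_le_mul_of_nonneg_left hAAB (by positivity)
    _ = 2 * K * (m : ℝ) ^ ((3 : ℝ) / 2) * lam ^ (n : ℝ) * e * Real.sqrt f := by
        rw [hm32]; ring

/-- The efficiency bound of card `efficiency-shadow`, PROVED. -/
theorem triadFluxBound_holds : TriadFluxBound :=
  fun _lam hlam _m coeff K hK X n t => triadFluxBound hlam coeff K hK X n t

/-! ## The reduction `AdversarialDyadicTrace → CircuitTrace` (card `efficiency-shadow`, Transfer), PROVED -/

/-- `CircuitTrace` through `circuitRHS` (definitionally the route decl). -/
def CircuitTrace' : Prop :=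
  ∀ lam : ℝ, 1 < lam → ∀ (m : ℕ) (coeff : Fin m → Fin m → Fin m → Option (Fin 3) → ℝ),
    (∀ (i₁ i₂ i₃ : Fin m) (μ : Option (Fin 3)),
      coeff i₁ i₂ i₃ μ = coeff i₂ i₁ i₃ (Option.map (Equiv.swap (0 : Fin 3) 1) μ)) →
    IsCyclic coeff → ∀ T : ℝ, 0 < T → ∀ X : Fin m → ℤ → ℝ → ℝ,
    (∀ (i : Fin m) (n : ℤ), ContinuousOn (X i n) (Set.Ico 0 T)) →
    (∀ (i : Fin m) (n : ℤ), ∀ t ∈ Set.Ioo 0 T, HasDerivAt (X i n) (circuitRHS lam coeff X i n t) t) →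
    (∀ (i : Fin m) (n : ℤ) (t : ℝ), n < 0 → X i n t = 0) →
    (∀ T' ∈ Set.Ioo 0 T, ∃ C : ℝ, ∀ (i : Fin m) (n : ℤ), ∀ t ∈ Set.Icc 0 T',
        lam ^ ((4 : ℝ) * n) * |X i n t| ≤ C) →
    (∃ M : ℝ, ∀ t ∈ Set.Ico 0 T, ∀ s : Finset ℤ,
        ∑ n ∈ s, ∑ i : Fin m, (lam ^ ((1 / 5 : ℝ) * n) * |X i n t|) ^ 3 ≤ M) →
    ∃ C : ℝ, ∀ (i : Fin m) (n : ℤ), ∀ t ∈ Set.Ico 0 T, lam ^ ((4 : ℝ) * n) * |X i n t| ≤ C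

theorem circuitTrace_iff : CircuitTrace ↔ CircuitTrace' := Iff.rfl

theorem exists_coeff_bound {m : ℕ} (coeff : Fin m → Fin m → Fin m → Option (Fin 3) → ℝ) :
    ∃ K : ℝ, 0 ≤ K ∧ ∀ i₁ i₂ i₃ μ, |coeff i₁ i₂ i₃ μ| ≤ K := by
  obtain ⟨M, hM⟩ := Finite.exists_le
    (fun q : Fin m × Fin m × Fin m × Option (Fin 3) => |coeff q.1 q.2.1 q.2.2.1 q.2.2.2|)
  exact ⟨max M 0, le_max_right _ _, fun i₁ i₂ i₃ μ => (hM (i₁, i₂, i₃, μ)).trans (le_max_left _ _)⟩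

theorem rpow_sq' {x : ℝ} (hx : 0 ≤ x) (y : ℝ) : (x ^ y) ^ 2 = x ^ (2 * y) := by
  rw [← Real.rpow_two, ← Real.rpow_mul hx]; ring_nf

/-- Power mean: `(Σ a²)^{3/2} ≤ √#s · Σ a³` for `a ≥ 0` (two Cauchy–Schwarz inequalities). -/
theorem powMean_three_halves {ι : Type*} (s : Finset ι) (a : ι → ℝ) (ha : ∀ i ∈ s, 0 ≤ a i) :
    (∑ i ∈ s, a i ^ 2) * Real.sqrt (∑ i ∈ s, a i ^ 2)
      ≤ Real.sqrt (s.card : ℝ) * ∑ i ∈ s, a i ^ 3 := by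
  set x := ∑ i ∈ s, a i ^ 2 with hx
  set S3 := ∑ i ∈ s, a i ^ 3 with hS3
  set S1 := ∑ i ∈ s, a i with hS1
  have hx0 : 0 ≤ x := Finset.sum_nonneg fun i _ => sq_nonneg _
  have hS30 : 0 ≤ S3 := Finset.sum_nonneg fun i hi => pow_nonneg (ha i hi) 3
  have hCS1 : x ^ 2 ≤ S3 * S1 := by
    have h := Finset.sum_mul_sq_le_sq_mul_sq s (fun i => a i * Real.sqrt (a i)) (fun i => Real.sqrt (a i))
    have e1 : ∀ i ∈ s, a i * Real.sqrt (a i) * Real.sqrt (a i) = a i ^ 2 := fun i hi => by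
      rw [mul_assoc, Real.mul_self_sqrt (ha i hi)]; ring
    have e2 : ∀ i ∈ s, (a i * Real.sqrt (a i)) ^ 2 = a i ^ 3 := fun i hi => by
      rw [mul_pow, Real.sq_sqrt (ha i hi)]; ring
    have e3 : ∀ i ∈ s, (Real.sqrt (a i)) ^ 2 = a i := fun i hi => Real.sq_sqrt (ha i hi)
    rw [Finset.sum_congr rfl e1, Finset.sum_congr rfl e2, Finset.sum_congr rfl e3] at h
    exact h
  have hS1 : S1 ≤ Real.sqrt (s.card : ℝ) * Real.sqrt x := by
    have h := sq_sum_le_card_mul_sum_sq (s := s) (f := a)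
    rw [← Real.sqrt_mul (Nat.cast_nonneg _)]
    exact (le_abs_self S1).trans (Real.abs_le_sqrt h)
  have h2 : x ^ 2 ≤ S3 * (Real.sqrt (s.card : ℝ) * Real.sqrt x) :=
    hCS1.trans (mul_le_mul_of_nonneg_left hS1 hS30)
  rcases eq_or_lt_of_le hx0 with hz | hpos
  · rw [← hz]; simp; positivity
  · have hsx : 0 < Real.sqrt x := Real.sqrt_pos.mpr hpos
    have key : (x * Real.sqrt x) * Real.sqrt x ≤ (Real.sqrt (s.card : ℝ) * S3) * Real.sqrt x := by
      have : (x * Real.sqrt x) * Real.sqrt x = x ^ 2 := by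
        rw [mul_assoc, Real.mul_self_sqrt hx0]; ring
      rw [this]; linarith [h2]
    exact le_of_mul_le_mul_right key hsx

theorem shadowReduction (hC : AdversarialDyadicTrace) : CircuitTrace := by
  rw [circuitTrace_iff]
  intro lam hlam m coeff _hsym hcyc T hT X hcont hderiv hcut hapr hM
  obtain ⟨M, hM⟩ := hM
  have hlam0 : 0 < lam := by linarith
  obtain ⟨K, hK0, hK⟩ := exists_coeff_bound coeff
  set K' : ℝ := 2 * K * (m : ℝ) ^ ((3 : ℝ) / 2) with hK'
  have hK'0 : 0 ≤ K' := by positivity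
  -- the shadow fields
  have h1 : ∀ (n : ℤ), ∀ t ∈ Set.Ico 0 T, 0 ≤ scaleEnergy X n t :=
    fun n t _ => Finset.sum_nonneg fun i _ => sq_nonneg _
  have h2 : ∀ (n : ℤ), ContinuousOn (scaleEnergy X n) (Set.Ico 0 T) := by
    intro n
    have : scaleEnergy X n = fun t => ∑ i : Fin m, (X i n t) ^ 2 := rfl
    rw [this]
    exact continuousOn_finsetSum _ fun i _ => (hcont i n).pow 2
  have h3 : ∀ (n : ℤ), ∀ t ∈ Set.Ioo 0 T,
      HasDerivAt (scaleEnergy X n) (-2 * lam ^ ((4 / 5 : ℝ) * n) * scaleEnergy X n t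
        + triadFlux lam coeff X (n - 1) t - triadFlux lam coeff X n t) t :=
    fun n t ht => efficiencyShadow hlam0 hcyc X n t (fun i n' => hderiv i n' t ht)
  have h4 : ∀ (n : ℤ), ∀ t ∈ Set.Ioo 0 T, |triadFlux lam coeff X n t|
      ≤ K' * lam ^ (n : ℝ) * scaleEnergy X n t * Real.sqrt (scaleEnergy X (n + 1) t) :=
    fun n t _ => triadFluxBound hlam0 coeff K hK X n t
  have h5 : ∀ (n : ℤ) (t : ℝ), n < 0 → scaleEnergy X n t = 0 := by
    intro n t hn
    simp [scaleEnergy, hcut _ n t hn]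
  have h6 : ∀ T' ∈ Set.Ioo 0 T, ∃ C : ℝ, ∀ (n : ℤ), ∀ t ∈ Set.Icc 0 T',
      lam ^ ((8 : ℝ) * n) * scaleEnergy X n t ≤ C := by
    intro T' hT'
    obtain ⟨C, hCb⟩ := hapr T' hT'
    refine ⟨(m : ℝ) * C ^ 2, fun n t ht => ?_⟩
    have hpow : lam ^ ((8 : ℝ) * n) = (lam ^ ((4 : ℝ) * n)) ^ 2 := by
      rw [rpow_sq' hlam0.le]; ring_nf
    calc lam ^ ((8 : ℝ) * n) * scaleEnergy X n t
        = ∑ i : Fin m, (lam ^ ((4 : ℝ) * n) * |X i n t|) ^ 2 := by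
          rw [hpow, scaleEnergy, Finset.mul_sum]
          refine Finset.sum_congr rfl fun i _ => ?_
          rw [mul_pow, sq_abs]
      _ ≤ ∑ _i : Fin m, C ^ 2 := by
          refine Finset.sum_le_sum fun i _ => ?_
          have h0 : 0 ≤ lam ^ ((4 : ℝ) * n) * |X i n t| := by positivity
          exact pow_le_pow_left₀ h0 (hCb i n t ht) 2
      _ = (m : ℝ) * C ^ 2 := by simp
  have h7 : ∃ M' : ℝ, ∀ t ∈ Set.Ico 0 T, ∀ s : Finset ℤ,
      ∑ n ∈ s, (lam ^ ((2 / 5 : ℝ) * n) * scaleEnergy X n t) ^ ((3 : ℝ) / 2) ≤ M' := by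
    refine ⟨Real.sqrt (m : ℝ) * M, fun t ht s => ?_⟩
    have hn : ∀ n : ℤ, (lam ^ ((2 / 5 : ℝ) * n) * scaleEnergy X n t) ^ ((3 : ℝ) / 2)
        ≤ Real.sqrt (m : ℝ) * ∑ i : Fin m, (lam ^ ((1 / 5 : ℝ) * n) * |X i n t|) ^ 3 := by
      intro n
      have hx : lam ^ ((2 / 5 : ℝ) * n) * scaleEnergy X n t
          = ∑ i : Fin m, (lam ^ ((1 / 5 : ℝ) * n) * |X i n t|) ^ 2 := by
        have hpow : lam ^ ((2 / 5 : ℝ) * n) = (lam ^ ((1 / 5 : ℝ) * n)) ^ 2 := by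
          rw [rpow_sq' hlam0.le]; ring_nf
        rw [hpow, scaleEnergy, Finset.mul_sum]
        refine Finset.sum_congr rfl fun i _ => ?_
        rw [mul_pow, sq_abs]
      have hx0 : 0 ≤ ∑ i : Fin m, (lam ^ ((1 / 5 : ℝ) * n) * |X i n t|) ^ 2 :=
        Finset.sum_nonneg fun i _ => sq_nonneg _
      rw [hx, three_halves_eq _ hx0]
      have := powMean_three_halves (Finset.univ : Finset (Fin m))
        (fun i => lam ^ ((1 / 5 : ℝ) * n) * |X i n t|) (fun i _ => by positivity)
      simpa [Finset.card_univ, Fintype.card_fin] using this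
    calc ∑ n ∈ s, (lam ^ ((2 / 5 : ℝ) * n) * scaleEnergy X n t) ^ ((3 : ℝ) / 2)
        ≤ ∑ n ∈ s, Real.sqrt (m : ℝ) * ∑ i : Fin m, (lam ^ ((1 / 5 : ℝ) * n) * |X i n t|) ^ 3 :=
          Finset.sum_le_sum fun n _ => hn n
      _ = Real.sqrt (m : ℝ) * ∑ n ∈ s, ∑ i : Fin m, (lam ^ ((1 / 5 : ℝ) * n) * |X i n t|) ^ 3 := by
          rw [Finset.mul_sum]
      _ ≤ Real.sqrt (m : ℝ) * M :=
          mul_le_mul_of_nonneg_left (hM t ht s) (Real.sqrt_nonneg _)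
  -- apply C⁺
  obtain ⟨C, hCb⟩ := hC lam hlam K' hK'0 T hT (scaleEnergy X) (triadFlux lam coeff X)
    h1 h2 h3 h4 h5 h6 h7
  refine ⟨Real.sqrt C, fun i n t ht => ?_⟩
  have hle : (lam ^ ((4 : ℝ) * n) * |X i n t|) ^ 2 ≤ C := by
    have hpow : lam ^ ((8 : ℝ) * n) = (lam ^ ((4 : ℝ) * n)) ^ 2 := by
      rw [rpow_sq' hlam0.le]; ring_nf
    have hsum : lam ^ ((8 : ℝ) * n) * scaleEnergy X n t
        = ∑ j : Fin m, (lam ^ ((4 : ℝ) * n) * |X j n t|) ^ 2 := by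
      rw [hpow, scaleEnergy, Finset.mul_sum]
      refine Finset.sum_congr rfl fun j _ => ?_
      rw [mul_pow, sq_abs]
    have hsingle : (lam ^ ((4 : ℝ) * n) * |X i n t|) ^ 2
        ≤ ∑ j : Fin m, (lam ^ ((4 : ℝ) * n) * |X j n t|) ^ 2 :=
      Finset.single_le_sum (f := fun j => (lam ^ ((4 : ℝ) * n) * |X j n t|) ^ 2)
        (fun j _ => sq_nonneg _) (Finset.mem_univ i)
    linarith [hCb n t ht, hsum ▸ hsingle]
  have h0 : 0 ≤ lam ^ ((4 : ℝ) * n) * |X i n t| := by positivity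
  calc lam ^ ((4 : ℝ) * n) * |X i n t| = abs (lam ^ ((4 : ℝ) * n) * |X i n t|) := (abs_of_nonneg h0).symm
    _ ≤ Real.sqrt C := Real.abs_le_sqrt hle

/-- The Transfer of card `efficiency-shadow`, PROVED: `CircuitTrace` is an instance of the scalar
adversarial trace theorem. -/
theorem shadowReduction_holds : ShadowReduction := shadowReduction

/-! ## Terminal limit (card `terminal-scar`, First lemma) -/

/-- Under a critical sup bound every mode has bounded derivative on `(0,T)`, hence a limit at `T⁻`. -/
theorem terminalLimit {lam : ℝ} (hlam : 1 < lam) {m : ℕ}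
    (coeff : Fin m → Fin m → Fin m → Option (Fin 3) → ℝ) (T : ℝ) (X : Fin m → ℤ → ℝ → ℝ)
    (hT : 0 < T)
    (hderiv : ∀ (i : Fin m) (n : ℤ), ∀ t ∈ Set.Ioo 0 T,
      HasDerivAt (X i n) (circuitRHS lam coeff X i n t) t)
    (_hcut : ∀ (i : Fin m) (n : ℤ) (t : ℝ), n < 0 → X i n t = 0)
    (hA : ∃ A : ℝ, ∀ (i : Fin m) (n : ℤ), ∀ t ∈ Set.Ico 0 T, lam ^ ((1 / 5 : ℝ) * n) * |X i n t| ≤ A)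
    (i : Fin m) (n : ℤ) :
    ∃ L : ℝ, Filter.Tendsto (X i n) (nhdsWithin T (Set.Iio T)) (nhds L) := by
  obtain ⟨A, hA⟩ := hA
  obtain ⟨K, hK0, hK⟩ := exists_coeff_bound coeff
  have hlam0 : 0 < lam := by linarith
  -- time-independent bounds on the modes
  set c : ℤ → ℝ := fun k => A / lam ^ ((1 / 5 : ℝ) * k) with hc_def
  have hpow : ∀ k : ℤ, 0 < lam ^ ((1 / 5 : ℝ) * k) := fun k => Real.rpow_pos_of_pos hlam0 _
  have hc : ∀ (i' : Fin m) (k : ℤ), ∀ t ∈ Set.Ioo 0 T, |X i' k t| ≤ c k := by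
    intro i' k t ht
    have h := hA i' k t ⟨ht.1.le, ht.2⟩
    rw [hc_def]
    simp only
    rw [le_div_iff₀ (hpow k)]
    linarith [mul_comm (lam ^ ((1 / 5 : ℝ) * k)) (|X i' k t|)]
  have hc0 : ∀ k : ℤ, 0 ≤ c k := by
    intro k
    have hT2 : T / 2 ∈ Set.Ioo 0 T := ⟨by linarith, by linarith⟩
    rcases Nat.eq_zero_or_pos m with hm | hm
    · -- no modes: A ≥ 0 is not forced, but `c k` is never used with modes; bound via hA vacuous?  use i
      exact (abs_nonneg _).trans (hc i k (T / 2) hT2)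
    · exact (abs_nonneg _).trans (hc i k (T / 2) hT2)
  -- the derivative bound
  set B : ℝ := lam ^ ((4 / 5 : ℝ) * n) * c n
      + ∑ i₁ : Fin m, ∑ i₂ : Fin m, ∑ μ : Option (Fin 3),
          K * lam ^ ((n : ℝ) - (if μ = some 2 then 1 else 0))
            * c (n + ((if μ = some 0 then 1 else 0) - (if μ = some 2 then 1 else 0)))
            * c (n + ((if μ = some 1 then 1 else 0) - (if μ = some 2 then 1 else 0))) with hB_def
  have hB : ∀ t ∈ Set.Ioo 0 T, |circuitRHS lam coeff X i n t| ≤ B := by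
    intro t ht
    unfold circuitRHS
    refine (abs_add_le _ _).trans (add_le_add ?_ ?_)
    · rw [abs_mul, abs_neg, abs_of_nonneg (Real.rpow_pos_of_pos hlam0 _).le]
      exact mul_le_mul_of_nonneg_left (hc i n t ht) (Real.rpow_pos_of_pos hlam0 _).le
    · refine (Finset.abs_sum_le_sum_abs _ _).trans (Finset.sum_le_sum fun i₁ _ => ?_)
      refine (Finset.abs_sum_le_sum_abs _ _).trans (Finset.sum_le_sum fun i₂ _ => ?_)
      refine (Finset.abs_sum_le_sum_abs _ _).trans (Finset.sum_le_sum fun μ _ => ?_)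
      rw [abs_mul, abs_mul, abs_mul, abs_of_nonneg (Real.rpow_pos_of_pos hlam0 _).le]
      have h1 := hK i₁ i₂ i μ
      have h2 := hc i₁ (n + ((if μ = some 0 then 1 else 0) - (if μ = some 2 then 1 else 0))) t ht
      have h3 := hc i₂ (n + ((if μ = some 1 then 1 else 0) - (if μ = some 2 then 1 else 0))) t ht
      have hl : 0 ≤ lam ^ ((n : ℝ) - (if μ = some 2 then 1 else 0)) := (Real.rpow_pos_of_pos hlam0 _).le
      have := mul_le_mul (mul_le_mul (mul_le_mul_of_nonneg_right h1 hl) h2 (abs_nonneg _)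
        (mul_nonneg hK0 hl)) h3 (abs_nonneg _) (mul_nonneg (mul_nonneg hK0 hl) (hc0 _))
      exact this
  have hB0 : 0 ≤ B := (abs_nonneg _).trans (hB (T / 2) ⟨by linarith, by linarith⟩)
  -- Lipschitz on (0,T)
  have hLip : ∀ s ∈ Set.Ioo 0 T, ∀ u ∈ Set.Ioo 0 T, ‖X i n u - X i n s‖ ≤ B * ‖u - s‖ := by
    intro s hs u hu
    refine (convex_Ioo 0 T).norm_image_sub_le_of_norm_hasDerivWithin_le
      (fun x hx => (hderiv i n x hx).hasDerivWithinAt) (fun x hx => ?_) hs hu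
    rw [Real.norm_eq_abs]
    exact hB x hx
  -- Cauchy at T⁻
  have hC : Cauchy (Filter.map (X i n) (nhdsWithin T (Set.Iio T))) := by
    refine Metric.cauchy_iff.2 ⟨inferInstance, fun ε hε => ?_⟩
    set δ : ℝ := ε / (2 * (B + 1)) with hδ
    have hδ0 : 0 < δ := by positivity
    set a : ℝ := max (T / 2) (T - δ) with ha
    have haT : a < T := max_lt (by linarith) (by linarith)
    have ha0 : 0 < a := lt_of_lt_of_le (by linarith) (le_max_left _ _)
    refine ⟨X i n '' Set.Ioo a T, Filter.image_mem_map (Ioo_mem_nhdsLT haT), ?_⟩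
    rintro _ ⟨s, hs, rfl⟩ _ ⟨u, hu, rfl⟩
    have hs' : s ∈ Set.Ioo 0 T := ⟨ha0.trans hs.1, hs.2⟩
    have hu' : u ∈ Set.Ioo 0 T := ⟨ha0.trans hu.1, hu.2⟩
    have h := hLip u hu' s hs'
    rw [Real.norm_eq_abs, Real.norm_eq_abs] at h
    rw [dist_eq_norm, Real.norm_eq_abs]
    have hsu : |s - u| ≤ δ := by
      have h1 : T - δ ≤ a := le_max_right _ _
      rw [abs_le]; constructor <;> linarith [hs.1, hs.2, hu.1, hu.2]
    calc |X i n s - X i n u| ≤ B * |s - u| := h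
      _ ≤ B * δ := mul_le_mul_of_nonneg_left hsu hB0
      _ < ε := by
          rw [hδ]
          have : B * (ε / (2 * (B + 1))) = ε * (B / (2 * (B + 1))) := by ring
          rw [this]
          have hfrac : B / (2 * (B + 1)) < 1 := by
            rw [div_lt_one (by positivity)]; linarith
          calc ε * (B / (2 * (B + 1))) < ε * 1 := mul_lt_mul_of_pos_left hfrac hε
            _ = ε := mul_one ε
  obtain ⟨L, hL⟩ := CompleteSpace.complete hC
  exact ⟨L, hL⟩

/-- The First lemma of card `terminal-scar`, PROVED. -/
theorem terminalLimit_holds : TerminalLimit :=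
  fun _lam hlam _m coeff T X hT hderiv hcut hA i n => terminalLimit hlam coeff T X hT hderiv hcut hA i n

/-! ## The scar endgame (card `terminal-scar`): `TerminalScar → CircuitTrace`, PROVED -/

theorem scarCloses (hscar : TerminalScar) : CircuitTrace := by
  rw [circuitTrace_iff]
  intro lam hlam m coeff hsym hcyc T hT X hcont hderiv hcut hapr hM
  obtain ⟨M, hM⟩ := hM
  have hlam0 : 0 < lam := by linarith
  by_contra hcon
  -- critical sup bound from the ℓ³ bound
  have hAbd : ∀ (i : Fin m) (n : ℤ), ∀ t ∈ Set.Ico 0 T,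
      lam ^ ((1 / 5 : ℝ) * n) * |X i n t| ≤ max M 1 := by
    intro i n t ht
    have h1 := hM t ht {n}
    rw [Finset.sum_singleton] at h1
    have h2 : (lam ^ ((1 / 5 : ℝ) * n) * |X i n t|) ^ 3 ≤ M :=
      le_trans (Finset.single_le_sum (f := fun i => (lam ^ ((1 / 5 : ℝ) * n) * |X i n t|) ^ 3)
        (fun j _ => by positivity) (Finset.mem_univ i)) h1
    have h0 : 0 ≤ lam ^ ((1 / 5 : ℝ) * n) * |X i n t| := by positivity
    by_contra hlt
    have hlt' := not_le.mp hlt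
    set x := lam ^ ((1 / 5 : ℝ) * n) * |X i n t| with hx
    have h3 : 1 ≤ x := (lt_of_le_of_lt (le_max_right _ _) hlt').le
    have h4 : M < x := lt_of_le_of_lt (le_max_left _ _) hlt'
    have h5 : x ≤ x ^ 3 :=
      calc x = x * 1 * 1 := by ring
        _ ≤ x * x * x := by gcongr
        _ = x ^ 3 := by ring
    linarith
  obtain ⟨ρ, hρ, hsc⟩ := hscar lam hlam m coeff hsym hcyc T hT X hcont hderiv hcut hapr (max M 1) hAbd hcon
  -- m = 0 is impossible (no modes, no scar)
  rcases Nat.eq_zero_or_pos m with hm0 | hmpos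
  · subst hm0
    obtain ⟨n, _, t₀, ht₀, hsc0⟩ := hsc 0
    have := hsc0 t₀ ⟨le_rfl, ht₀.2⟩
    simp at this
    linarith
  -- choose the scarred scales and their final intervals
  choose f hf using hsc
  choose t₀ ht₀ hwin using fun N => (hf N).2
  have hfN : ∀ N : ℕ, (N : ℤ) ≤ f N := fun N => (hf N).1
  -- a strictly increasing selection of indices
  let g : ℕ → ℕ := fun j => Nat.rec 0 (fun _ prev => Int.toNat (f prev) + 1) j
  have hg_succ : ∀ j, g (j + 1) = Int.toNat (f (g j)) + 1 := fun j => rfl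
  have hmono : StrictMono (fun j => f (g j)) := by
    refine strictMono_nat_of_lt_succ fun j => ?_
    have h1 : ((g (j + 1) : ℕ) : ℤ) ≤ f (g (j + 1)) := hfN _
    rw [hg_succ] at h1
    push_cast at h1
    have h2 : f (g j) ≤ (Int.toNat (f (g j)) : ℤ) := Int.self_le_toNat _
    linarith
  have hinj : Function.Injective (fun j => f (g j)) := hmono.injective
  -- how many scales we need
  obtain ⟨k, hk⟩ := exists_nat_gt (M * (m : ℝ) ^ 2 / ρ ^ 3)
  have hkpos : 0 < k + 1 := Nat.succ_pos k
  set S : Finset ℤ := (Finset.range (k + 1)).image (fun j => f (g j)) with hS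
  have hScard : S.card = k + 1 := by
    rw [hS, Finset.card_image_of_injective _ hinj, Finset.card_range]
  -- the latest starting time among the chosen windows
  obtain ⟨jstar, hjstar, hmax⟩ := Finset.exists_max_image (Finset.range (k + 1)) (fun j => t₀ (g j))
    ⟨0, Finset.mem_range.mpr hkpos⟩
  set tstar : ℝ := t₀ (g jstar) with htstar
  have htstarT : tstar ∈ Set.Ico 0 T := ht₀ (g jstar)
  -- every chosen scale is scarred at time tstar
  have hlow : ∀ n ∈ S, ρ ^ 3 / (m : ℝ) ^ 2
      ≤ ∑ i : Fin m, (lam ^ ((1 / 5 : ℝ) * n) * |X i n tstar|) ^ 3 := by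
    intro n hn
    rw [hS, Finset.mem_image] at hn
    obtain ⟨j, hj, rfl⟩ := hn
    have hwin_j := hwin (g j) tstar ⟨hmax j hj, htstarT.2⟩
    -- power mean: (Σ y)^3 / m^2 ≤ Σ y^3
    set y : Fin m → ℝ := fun i => lam ^ ((1 / 5 : ℝ) * (f (g j))) * |X i (f (g j)) tstar| with hy
    have hy0 : ∀ i ∈ (Finset.univ : Finset (Fin m)), 0 ≤ y i := fun i _ => by positivity
    have hsum : ρ ≤ ∑ i : Fin m, y i := by
      rw [hy]; simpa [Finset.mul_sum] using hwin_j
    have hpm := pow_sum_div_card_le_sum_pow (s := (Finset.univ : Finset (Fin m))) (f := y) hy0 2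
    simp only [Finset.card_univ, Fintype.card_fin] at hpm
    have hρ3 : ρ ^ 3 ≤ (∑ i : Fin m, y i) ^ 3 := by
      exact pow_le_pow_left₀ hρ.le hsum 3
    have hm2 : (0 : ℝ) < (m : ℝ) ^ 2 := by positivity
    calc ρ ^ 3 / (m : ℝ) ^ 2 ≤ (∑ i : Fin m, y i) ^ 3 / (m : ℝ) ^ 2 :=
          div_le_div_of_nonneg_right hρ3 hm2.le
      _ ≤ ∑ i : Fin m, y i ^ 3 := hpm
      _ = ∑ i : Fin m, (lam ^ ((1 / 5 : ℝ) * (f (g j))) * |X i (f (g j)) tstar|) ^ 3 := by rw [hy]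
  -- contradiction with the ℓ³ bound at time tstar
  have hsumS := hM tstar htstarT S
  have hge : (S.card : ℝ) * (ρ ^ 3 / (m : ℝ) ^ 2)
      ≤ ∑ n ∈ S, ∑ i : Fin m, (lam ^ ((1 / 5 : ℝ) * n) * |X i n tstar|) ^ 3 := by
    have := Finset.card_nsmul_le_sum S
      (fun n => ∑ i : Fin m, (lam ^ ((1 / 5 : ℝ) * n) * |X i n tstar|) ^ 3) (ρ ^ 3 / (m : ℝ) ^ 2) hlow
    simpa [nsmul_eq_mul] using this
  rw [hScard] at hge
  have hρ3pos : 0 < ρ ^ 3 / (m : ℝ) ^ 2 := by positivity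
  have hk' : M < ((k + 1 : ℕ) : ℝ) * (ρ ^ 3 / (m : ℝ) ^ 2) := by
    have hm2 : (0 : ℝ) < (m : ℝ) ^ 2 := by positivity
    have e1 : M = (M * (m : ℝ) ^ 2 / ρ ^ 3) * (ρ ^ 3 / (m : ℝ) ^ 2) := by
      field_simp
    rw [e1]
    refine mul_lt_mul_of_pos_right ?_ hρ3pos
    push_cast
    linarith
  linarith

/-- The endgame of card `terminal-scar`, PROVED: the terminal scar theorem (C⁺) implies the crux, by the
two-line Fatou/evaluation bookkeeping (k > m²M/ρ³ scarred scales at the latest starting time, power mean, ℓ³). -/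
theorem scarCloses_holds : ScarCloses := scarCloses

/-- The First lemma of card `efficiency-shadow`, PROVED. -/
theorem efficiencyShadow_holds : EfficiencyShadow :=
  fun _lam hlam _m _coeff hcyc X n t hX => efficiencyShadow hlam hcyc X n t hX

end Summit.NavierStokesRegularity.NavierStokesRegularity.Cruxes.CircuitTrace.Ideator2G2
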